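import Summits.HodgeConjecture.HodgeConjecture.Theses.CurveNetMordellWeil
import Literature.AlgebraicGeometry.Motives.FamiliesVHS
import Literature.AlgebraicGeometry.HodgeTheory.IsoTransport

/-!
# Route CurveNetMordellWeil · crux `VerticalSupportFourfolds` (stmt-HodgeConjecture-2784) —
# the ANCHOR + TRANSPORT decomposition at (n, p) = (4, 2)

Crux-strategist split (wall-breaker pass, 2026-08-17). The crux `VerticalSupportFourfolds`
("every rational `(2,2)`-class on a smooth projective fourfold with a surjection onto `ℙ³` is
algebraic modulo vertical rational `(2,2)`-classes") is, by the landed sandwich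
`hodgeTwoTwo_le_algebraicClasses_of_verticalSupportFourfolds` / `verticalSupportFourfolds_of_hodgeTwoTwo`
(p106042) and `CurveNetExists`, the Hodge conjecture in codimension `2` for ALL smooth projective
fourfolds. Two ideation rounds (7 cards) and one lead line died on reformulations of that fact.

This file records the one typed decomposition of the crux into two pieces NEITHER of which is the
crux reworded and NEITHER of which is summit-strength: the `(4,2)`-slice of Grothendieck's
anchor + transport frame (route `AnchorTransport`, items stmt-HodgeConjecture-1076/1077, there
stated for all `(n, p)`):

* `VariationalHodgeFourfolds` — Grothendieck's VARIATIONAL Hodge conjecture for `(2,2)`-classes in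
  smooth projective families of FOURFOLDS over a smooth irreducible base (global-class form on the
  real carriers): a global class, fibrewise rational of type `(2,2)`, algebraic on one fibre is
  algebraic on every fibre. Codimension `2` is the range of the sheaf-theoretic engines: Bloch's
  semiregularity for lci surfaces in fourfolds, the Buchweitz–Flenner semiregularity map for
  sheaves/complexes and Pridham's obstruction theorem, Perry's Mukai-vector deformation for CY2
  categories (cubic / Gushel–Mukai fourfolds) and its 2026 equivariant version, Markman's transport
  of Weil classes along the Weil locus of abelian fourfolds. NOT implied by HC(2,2) for fourfolds
  (HC ⇒ VHC needs HC on a compactified total space of dimension `4 + dim S`).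
* `AnchorExistenceFourfolds` — GEOGRAPHY of Hodge loci of `(2,2)`-classes in fourfold families:
  every pair `(X⁴, c)` is (up to iso) a fibre of such a family carrying a global fibrewise-Hodge
  class which is ALGEBRAIC on some fibre. Implied by HC(2,2)(X) (constant family), believed
  strictly weaker; the `(4,2)` geography has its own literature (Otwinowska's components of small
  codimension for hypersurfaces in `ℙ⁵`, Klingler–Otwinowska–Urbanik density of typical loci in
  level `≤ 2`, Movasati–Villaflor / Duque Franco–Villaflor computations at the Fermat sextic,
  the tadpole/short-vector codimension bound).

`verticalSupportFourfolds_of_subs : (VariationalHodgeFourfolds) → (AnchorExistenceFourfolds) →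
VerticalSupportFourfolds` — with the two sub-crux statements written out as BINDER TYPES (they
become the route decls `CurveNetMordellWeil.VariationalHodgeFourfolds` /
`CurveNetMordellWeil.AnchorExistenceFourfolds` through `ledger route edit --split`, whose generated
glue item `VariationalHodgeFourfolds → AnchorExistenceFourfolds → VerticalSupportFourfolds` this
theorem closes by `fun h₁ h₂ ↦ verticalSupportFourfolds_of_subs h₁ h₂` up to `δ`-unfolding; no
conjecture is DEFINED in this file, so nothing is vendored) — is pure logic plus the invariance of
`algebraicClasses` under isomorphisms of `ℂ`-schemes (`algebraicClasses_map_of_iso`, from the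
tree's `HodgeTheory/IsoTransport`, so that the file imports no other route): anchor datum,
transport to the fibre `s₁`, across `e : X ≅ 𝒳_{s₁}`, and the algebraic summand of the crux's
right-hand side (`le_sup_left`).

## References

* A. Grothendieck, *On the de Rham cohomology of algebraic varieties*, Publ. Math. IHÉS 29 (1966),
  footnote 13. [Grothendieck1966]
* F. Charles, C. Schnell, *Notes on absolute Hodge classes* (2014), Conj. 11.3.1, Prop. 11.3.5,
  Cor. 11.3.6. [CharlesSchnell2014Notes]
* S. Bloch, *Semi-regularity and de Rham cohomology*, Invent. Math. 17 (1972). [Bloch1972Semiregularity]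
* R.-O. Buchweitz, H. Flenner, *A semiregularity map for modules and applications to deformations*,
  Compos. Math. 137 (2003). [BuchweitzFlenner2003]
* A. Perry, *The integral Hodge conjecture for two-dimensional Calabi–Yau categories*, Compos.
  Math. 158 (2022), arXiv:2004.03163; *The semiregularity theorem for equivariant noncommutative
  varieties*, arXiv:2604.00511.
* E. Markman, *Cycles on abelian 2n-folds of Weil type from secant sheaves on abelian n-folds*,
  arXiv:2502.03415. [Markman2025SecantWeil]
* E. Cattani, P. Deligne, A. Kaplan, *On the locus of Hodge classes*, JAMS 8 (1995).
  [CattaniDeligneKaplan1995JAMS]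
* A. Otwinowska, Compos. Math. 131 (2002); J. Algebraic Geom. 12 (2003), arXiv:math/0401092.
* H. Movasati, R. Villaflor Loyola, *Periods of linear algebraic cycles*, PAMQ 14 (2018),
  arXiv:1705.00084; J. Duque Franco, R. Villaflor Loyola, *On fake linear cycles inside Fermat
  varieties*, ANT 17 (2023), arXiv:2112.14818.
* G. Baldi, B. Klingler, E. Ullmo, *On the distribution of the Hodge locus*, Invent. Math. (2024).
  [BaldiKlinglerUllmo2024]
-/

noncomputable section

set_option linter.dupNamespace false

open CategoryTheory AlgebraicGeometry
open Literature.AlgebraicGeometry Literature.AlgebraicGeometry.Motives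
  Literature.AlgebraicGeometry.HodgeTheory

namespace Summit.HodgeConjecture.HodgeConjecture.Theorems.VerticalSupportFourfoldsSplit

/-! ## The two sub-cruxes (as binder types)

* SUB-CRUX 1 `VariationalHodgeFourfolds` — Grothendieck's VARIATIONAL Hodge conjecture for
  `(2,2)`-classes in smooth projective families of fourfolds over a smooth irreducible base
  (Grothendieck 1966 fn. 13; Charles–Schnell Conj. 11.3.1, global-class form on the real carriers;
  the `(n,p) = (4,2)` slice of `AnchorTransport.VariationalHodge`, stmt-HodgeConjecture-1076):
  `∀ ⦃𝒳 S : SchemeOver ℂ⦄ (f : 𝒳 ⟶ S), IsSmoothProjectiveFamily f 4 → IrreducibleSpace S.left → …`.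
* SUB-CRUX 2 `AnchorExistenceFourfolds` — anchor existence = geography of Hodge loci of
  `(2,2)`-classes in fourfold families (the `(4,2)` slice of `AnchorTransport.AnchorExistence`,
  stmt-HodgeConjecture-1077): every `(X⁴, c)` is, up to `e : X ≅ 𝒳_{s₁}`, a fibre class of a global
  fibrewise rational `(2,2)` class on a smooth projective family of fourfolds over a smooth
  irreducible base which is ALGEBRAIC on some fibre `𝒳_{s₀}`.
-/

/-- **Algebraic classes are transported by isomorphisms of `ℂ`-schemes**: for `e : X ≅ Y` and
`c ∈ algebraicClasses Y p`, `e^* c ∈ algebraicClasses X p` — the backward implication of the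
tree's hypothesis-free `mem_algebraicClasses_map_iff_of_iso` (`HodgeTheory/IsoTransport`: an
isomorphism preserves closed subsets and codimension). Same content as the landed item
`AnchorTransport.IsoInvariance`; stated here so that this file imports no other route.
[cite: GrothendieckTopology1969, §1] -/
theorem algebraicClasses_map_of_iso {X Y : SchemeOver ℂ} (e : X ≅ Y) (p : ℕ)
    {c : complexBetti Y (2 * p)} (hc : c ∈ algebraicClasses Y p) :
    complexBetti.map e.hom (2 * p) c ∈ algebraicClasses X p :=
  (mem_algebraicClasses_map_iff_of_iso e).2 hc

/-- **Anchor + transport at `(4,2)` give HC(2,2) pointwise**: under the variational sub-crux `hV`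
and the anchor sub-crux `hAn`, every rational `(2,2)`-class on every smooth projective fourfold is
algebraic — take the anchor datum of `(X, c)`, transport algebraicity from `s₀` to `s₁` by `hV`,
and across `e : X ≅ 𝒳_{s₁}` by `algebraicClasses_map_of_iso`. [cite: CharlesSchnell2014Notes, Conj. 11.3.1] -/
theorem hodgeTwoTwo_mem_algebraicClasses_of_subs
    (hV : ∀ ⦃𝒳 S : SchemeOver ℂ⦄ (f : 𝒳 ⟶ S), IsSmoothProjectiveFamily f 4 → IrreducibleSpace S.left →
      AlgebraicGeometry.Smooth S.hom → ∀ A : complexBetti 𝒳 (2 * 2),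
        (∀ s : ComplexPoints S, IsRationalClass (complexBetti.map (fiberι f s) (2 * 2) A) ∧
          IsOfHodgeType 4 (fiberOver f s) (2 * 2) 2 2 (complexBetti.map (fiberι f s) (2 * 2) A)) →
        (∃ s₀ : ComplexPoints S,
          complexBetti.map (fiberι f s₀) (2 * 2) A ∈ algebraicClasses (fiberOver f s₀) 2) →
        ∀ s : ComplexPoints S,
          complexBetti.map (fiberι f s) (2 * 2) A ∈ algebraicClasses (fiberOver f s) 2)
    (hAn : ∀ ⦃X : SchemeOver ℂ⦄, IsSmoothProjective 4 X → ∀ c : complexBetti X (2 * 2),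
      IsRationalClass c → IsOfHodgeType 4 X (2 * 2) 2 2 c →
        ∃ (𝒳 S : SchemeOver ℂ) (f : 𝒳 ⟶ S) (s₁ s₀ : ComplexPoints S) (e : X ≅ fiberOver f s₁)
          (A : complexBetti 𝒳 (2 * 2)),
          IsSmoothProjectiveFamily f 4 ∧ IrreducibleSpace S.left ∧ AlgebraicGeometry.Smooth S.hom ∧
          (∀ s : ComplexPoints S, IsRationalClass (complexBetti.map (fiberι f s) (2 * 2) A) ∧
            IsOfHodgeType 4 (fiberOver f s) (2 * 2) 2 2 (complexBetti.map (fiberι f s) (2 * 2) A)) ∧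
          complexBetti.map e.hom (2 * 2) (complexBetti.map (fiberι f s₁) (2 * 2) A) = c ∧
          complexBetti.map (fiberι f s₀) (2 * 2) A ∈ algebraicClasses (fiberOver f s₀) 2)
    ⦃X : SchemeOver ℂ⦄ (hX : IsSmoothProjective 4 X)
    (c : complexBetti X (2 * 2)) (hc : IsRationalClass c) (hpp : IsOfHodgeType 4 X (2 * 2) 2 2 c) :
    c ∈ algebraicClasses X 2 := by
  obtain ⟨𝒳, S, f, s₁, s₀, e, A, hf, hirr, hsm, hfib, hAc, hs₀⟩ := hAn hX c hc hpp
  have h₁ := hV f hf hirr hsm A hfib ⟨s₀, hs₀⟩ s₁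
  have h₂ := algebraicClasses_map_of_iso e 2 h₁
  rw [hAc] at h₂
  exact h₂

/-- **The split** `VariationalHodgeFourfolds → AnchorExistenceFourfolds → VerticalSupportFourfolds`
(crux-strategist decomposition of stmt-HodgeConjecture-2784; the two hypotheses are the sub-crux
statements verbatim). The sub-cruxes give HC(2,2) on the fourfold
(`hodgeTwoTwo_mem_algebraicClasses_of_subs`), and the algebraic classes are the first summand of
the crux's right-hand side; the surjection `pr : X ⟶ ℙ³` is not used (the crux is net-independent:
on fourfolds verticality IS algebraicity, IdeatorFour P0 / IdeatorFive §1 of the crux dossier).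
Conclusion: literally the route decl
`Summit.HodgeConjecture.HodgeConjecture.Theses.CurveNetMordellWeil.VerticalSupportFourfolds`.
[cite: CharlesSchnell2014Notes, Conj. 11.3.1 and Cor. 11.3.6] -/
theorem verticalSupportFourfolds_of_subs
    (hV : ∀ ⦃𝒳 S : SchemeOver ℂ⦄ (f : 𝒳 ⟶ S), IsSmoothProjectiveFamily f 4 → IrreducibleSpace S.left →
      AlgebraicGeometry.Smooth S.hom → ∀ A : complexBetti 𝒳 (2 * 2),
        (∀ s : ComplexPoints S, IsRationalClass (complexBetti.map (fiberι f s) (2 * 2) A) ∧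
          IsOfHodgeType 4 (fiberOver f s) (2 * 2) 2 2 (complexBetti.map (fiberι f s) (2 * 2) A)) →
        (∃ s₀ : ComplexPoints S,
          complexBetti.map (fiberι f s₀) (2 * 2) A ∈ algebraicClasses (fiberOver f s₀) 2) →
        ∀ s : ComplexPoints S,
          complexBetti.map (fiberι f s) (2 * 2) A ∈ algebraicClasses (fiberOver f s) 2)
    (hAn : ∀ ⦃X : SchemeOver ℂ⦄, IsSmoothProjective 4 X → ∀ c : complexBetti X (2 * 2),
      IsRationalClass c → IsOfHodgeType 4 X (2 * 2) 2 2 c →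
        ∃ (𝒳 S : SchemeOver ℂ) (f : 𝒳 ⟶ S) (s₁ s₀ : ComplexPoints S) (e : X ≅ fiberOver f s₁)
          (A : complexBetti 𝒳 (2 * 2)),
          IsSmoothProjectiveFamily f 4 ∧ IrreducibleSpace S.left ∧ AlgebraicGeometry.Smooth S.hom ∧
          (∀ s : ComplexPoints S, IsRationalClass (complexBetti.map (fiberι f s) (2 * 2) A) ∧
            IsOfHodgeType 4 (fiberOver f s) (2 * 2) 2 2 (complexBetti.map (fiberι f s) (2 * 2) A)) ∧
          complexBetti.map e.hom (2 * 2) (complexBetti.map (fiberι f s₁) (2 * 2) A) = c ∧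
          complexBetti.map (fiberι f s₀) (2 * 2) A ∈ algebraicClasses (fiberOver f s₀) 2) :
    Summit.HodgeConjecture.HodgeConjecture.Theses.CurveNetMordellWeil.VerticalSupportFourfolds := by
  intro X pr hX _
  refine le_trans (Submodule.span_le.2 ?_) le_sup_left
  rintro c ⟨hc, hpp⟩
  exact hodgeTwoTwo_mem_algebraicClasses_of_subs hV hAn hX c hc hpp

/-- **Refuter-facing bookkeeping for sub-crux 2**: an anchor datum FORCES the two hypotheses on
`c` — it is rational (pull-back of `ℚ`-valued cocycles) and of type `(2,2)` (Hodge types transport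
along `e : X ≅ 𝒳_{s₁}`, `isOfHodgeType_map_iff_of_iso`) — so neither hypothesis of
`AnchorExistenceFourfolds` can be dropped (cf. `anchorExistence_false_without_isRationalClass` for
the general crux, `Theorems/AnchorExistence/Negative/LoadBearing.lean`). [cite: HatcherAT2002, §3.1] -/
theorem isRationalClass_and_isOfHodgeType_of_anchor ⦃X : SchemeOver ℂ⦄ {c : complexBetti X (2 * 2)}
    (h : ∃ (𝒳 S : SchemeOver ℂ) (f : 𝒳 ⟶ S) (s₁ s₀ : ComplexPoints S) (e : X ≅ fiberOver f s₁)
        (A : complexBetti 𝒳 (2 * 2)),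
        IsSmoothProjectiveFamily f 4 ∧ IrreducibleSpace S.left ∧ AlgebraicGeometry.Smooth S.hom ∧
        (∀ s : ComplexPoints S, IsRationalClass (complexBetti.map (fiberι f s) (2 * 2) A) ∧
          IsOfHodgeType 4 (fiberOver f s) (2 * 2) 2 2 (complexBetti.map (fiberι f s) (2 * 2) A)) ∧
        complexBetti.map e.hom (2 * 2) (complexBetti.map (fiberι f s₁) (2 * 2) A) = c ∧
        complexBetti.map (fiberι f s₀) (2 * 2) A ∈ algebraicClasses (fiberOver f s₀) 2) :
    IsRationalClass c ∧ IsOfHodgeType 4 X (2 * 2) 2 2 c := by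
  obtain ⟨𝒳, S, f, s₁, s₀, e, A, -, -, -, hfib, hAc, -⟩ := h
  rw [← hAc]
  exact ⟨(hfib s₁).1.pullback _, (isOfHodgeType_map_iff_of_iso e).2 (hfib s₁).2⟩

end Summit.HodgeConjecture.HodgeConjecture.Theorems.VerticalSupportFourfoldsSplit

end
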